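import Summits.QuantumFields.YangMills.Theorems.FluctuationComparisonRegPrIntLOrganTangentWindowGaugeInvariance
import Mathlib.Analysis.Complex.CauchyIntegral
import Mathlib.Analysis.Complex.RealDeriv
import Mathlib.Analysis.Calculus.MeanValue
import HarnessLib

/-!
# THE SECOND-ORDER ANCHOR LETTER, BY KERNEL: a one-parameter move function that is the real trace of a holomorphic `g` with oscillation
# `≤ B` on a disc, and whose derivative at the anchor VANISHES (gauge invariance at the flat field, ✓p794698 ∕ ✓p793256), moves by at most
# `(32B∕r²)·(|s|∕θ)²` — TN-GR's «anchor letter G is second order» (ideator №23, booked for g27)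

Cell `ym3-torus` (YM ladder rung R3 = continuum `SU(2)` Yang–Mills on the three-torus — a RUNG, NOT d = 4, NOT infinite volume, NOT a mass
gap, NOT Clay).  LEAD-20520 width seat `ym-ust-20520-w3` (gen 24); `--supports stmt-QuantumFields-20520 --as helper`, count-neutral,
definition-free, default heartbeats; no registry, binder or `Lines/` edit (registered skeleton `Lines/semiclassical_s2beta.lean` v11.4, 0∕5,
★★OWNER RULING №36, untouched).

WHAT THIS IS.  Ideator `ym-r3-idea-1` g26 №23 (memo `CURRENCY-MEMO-g26.md` §10.10): in the (GR-a) organ telescope the anchor letter `G` («how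
far does the remainder move along ONE window-size one-bond move from the flat anchor») is SECOND ORDER — `GRFlatEven.flatGradient_zero` ∕
✓`OrganTangentFlatAnchorEven.deriv_flatBond_eq_zero` kill the first-order term, and (β)'s one-variable Cauchy∕C² bound supplies the rest;
the remaining inputs were (i) gauge invariance of the organ's remainder (✓p794698 `gaugeInvariant_organDiscrepancy`) and (iv) differentiability
at the anchor «from (β)».  This file types both arrows:

* §1 one-variable Cauchy tools on a disc `ball 0 ρ` for `f : ℂ → ℂ` complex-differentiable there with oscillation `‖f z − f 0‖ ≤ B`:
  `norm_deriv_le_of_osc_ball` (`‖f′ w‖ ≤ 4B∕ρ` for `‖w‖ ≤ ρ∕4`), `norm_deriv_deriv_le` (`‖f″ σ‖ ≤ 32B∕ρ²` for `‖σ‖ ≤ ρ∕8`, via Mathlib's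
  `DifferentiableOn.deriv`), ★`norm_sub_le_sq_of_deriv_eq_zero` — if moreover `f′ 0 = 0` then `‖f s − f 0‖ ≤ (32B∕ρ²)·‖s‖²` for `‖s‖ ≤ ρ∕8`
  (mean value twice), and its scaled∕real reading `abs_sub_le_sq_scaled_real` (`ρ = r·θ`: `≤ (32B∕r²)·(|s|∕θ)²`).
* §2 (iv) FROM (β): ★`hasDerivAt_realTrace` — if `φ : ℝ → ℝ` is the real trace of `f` (`f ↑s = ↑(φ s)` for `|s| < ρ`) then `φ` is differentiable
  at `0` with `↑(deriv φ 0) = deriv f 0`; hence ★`deriv_eq_zero_of_realTrace` — `deriv φ 0 = 0 → deriv f 0 = 0` (the complex derivative of a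
  real-on-reals function at a real point is the real derivative).
* §3 ★★`abs_flatBond_organDiscrepancy_sub_le_sq` — DOCKED: in the organ's frame (clause ⑧ for both towers at height `j`, ✓p794698), for a bond
  `b`, an inversion-odd one-bond curve `e` through `1` (`e(−t) = (e t)⁻¹`), and a (β)-shaped one-parameter datum (`f` holomorphic on
  `ball 0 (r·θ)`, oscillation `≤ B`, real trace = the remainder along `t ↦ update 1 b (e t)`), the anchor letter is second order:
  `|Rem (update 1 b (e s)) − Rem 1| ≤ (32B∕r²)·(|s|∕θ)²` for `|s| ≤ r·θ∕8`, where `Rem U := log ρ_j U − log ρ′_j U − a·Σ_p c_p (1 − reTr U(∂p))`.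
  No differentiability hypothesis is left: (iv) is discharged by §2 from the same datum.

WHAT THIS IS NOT.  Folklore complex analysis + the landed symmetry lemma; nothing of Bałaban's (that the runs' densities have such holomorphic
one-bond traces with usable `B` is [Balaban1985UV3] p.263's claim, the D-item (β), not formalised); O1∕O1ᵘ-H∕S3ᴴ, the five registered
∘-stubs, crux 20520 `FluctuationComparisonRegPrIntL`, `YM3TorusSU2` NOT proved; no summit is proved by a helper.  R3 = SU(2) YM₃ on T³ —
NOT d = 4, NOT infinite volume, NOT a mass gap, NOT Clay; the Yang–Mills mass gap is NOT proved.
-/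

noncomputable section

open Metric Set Complex Function
open Literature.MathematicalPhysics.QuantumFieldTheory
open Literature.MathematicalPhysics.QuantumFieldTheory.Balaban1983to89
open Literature.MathematicalPhysics.QuantumFieldTheory.Balaban1983to89.T3ContinuumYM3Torus
open Literature.MathematicalPhysics.QuantumFieldTheory.Balaban1983to89.BalabanUVClass
open Literature.MathematicalPhysics.QuantumFieldTheory.Balaban1983to89.T3UnitLawDensityEML (ℰp)
open Summit.QuantumFields.YangMills.Theorems.OrganTangentWindowGaugeInvariance
  (gaugeInvariant_organDiscrepancy deriv_flatBond_organDiscrepancy_eq_zero)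

namespace Summit.QuantumFields.YangMills.Theorems.OrganTangentAnchorSecondOrder

/-! ## §1 One-variable Cauchy tools and the second-order bound under a vanishing derivative -/

section OneVariable

variable {f : ℂ → ℂ} {ρ B : ℝ}

/-- A closed disc of radius `R` around a point of norm `≤ δ` lies in `ball 0 ρ` when `δ + R < ρ`. [folklore] -/
theorem closedBall_subset_ball' {δ R : ℝ} {c : ℂ} (hc : ‖c‖ ≤ δ) (h : δ + R < ρ) : closedBall c R ⊆ ball (0 : ℂ) ρ := by
  intro w hw
  rw [mem_closedBall, dist_eq_norm] at hw
  rw [mem_ball, dist_zero_right]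
  calc ‖w‖ = ‖(w - c) + c‖ := by rw [sub_add_cancel]
    _ ≤ ‖w - c‖ + ‖c‖ := norm_add_le _ _
    _ ≤ R + δ := add_le_add hw hc
    _ < ρ := by linarith

/-- CAUCHY FROM THE OSCILLATION: `‖f′ w‖ ≤ 2B∕(ρ∕2)` for `‖w‖ ≤ ρ∕4` when `f` is complex-differentiable on `ball 0 ρ` with `‖f z − f 0‖ ≤ B`
there (sphere of radius `ρ∕2` around `w`; `‖f z − f w‖ ≤ 2B`). [folklore] -/
theorem norm_deriv_le_of_osc_ball (hρ : 0 < ρ) (hf : DifferentiableOn ℂ f (ball (0 : ℂ) ρ))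
    (hB : ∀ z ∈ ball (0 : ℂ) ρ, ‖f z - f 0‖ ≤ B) {w : ℂ} (hw : ‖w‖ ≤ ρ / 4) :
    ‖deriv f w‖ ≤ 2 * B / (ρ / 2) := by
  have hsub : closedBall w (ρ / 2) ⊆ ball (0 : ℂ) ρ := closedBall_subset_ball' hw (by linarith)
  have hd' : DiffContOnCl ℂ (fun z => f z - f w) (ball w (ρ / 2)) := by
    refine DifferentiableOn.diffContOnCl ?_
    rw [closure_ball w (half_pos hρ).ne']
    exact (hf.mono hsub).sub_const _
  have hM : ∀ z ∈ sphere w (ρ / 2), ‖f z - f w‖ ≤ 2 * B := by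
    intro z hz
    have hz' : z ∈ ball (0 : ℂ) ρ := hsub (sphere_subset_closedBall hz)
    have hw' : w ∈ ball (0 : ℂ) ρ := hsub (mem_closedBall_self (half_pos hρ).le)
    calc ‖f z - f w‖ = ‖(f z - f 0) - (f w - f 0)‖ := by rw [sub_sub_sub_cancel_right]
      _ ≤ ‖f z - f 0‖ + ‖f w - f 0‖ := norm_sub_le _ _
      _ ≤ B + B := add_le_add (hB z hz') (hB w hw')
      _ = 2 * B := by ring
  have key := Complex.norm_deriv_le_of_forall_mem_sphere_norm_le (half_pos hρ) hd' hM
  rwa [deriv_sub_const] at key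

/-- CAUCHY FOR THE SECOND DERIVATIVE: `‖f″ σ‖ ≤ (2B∕(ρ∕2))∕(ρ∕8)` for `‖σ‖ ≤ ρ∕8` (the derivative is holomorphic on the ball — Mathlib's
`DifferentiableOn.deriv` — and bounded by `2B∕(ρ∕2)` on the closed disc of radius `ρ∕4`, which contains the sphere of radius `ρ∕8` around `σ`).
[folklore] -/
theorem norm_deriv_deriv_le (hρ : 0 < ρ) (hf : DifferentiableOn ℂ f (ball (0 : ℂ) ρ))
    (hB : ∀ z ∈ ball (0 : ℂ) ρ, ‖f z - f 0‖ ≤ B) {σ : ℂ} (hσ : ‖σ‖ ≤ ρ / 8) :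
    ‖deriv (deriv f) σ‖ ≤ (2 * B / (ρ / 2)) / (ρ / 8) := by
  have hD : DifferentiableOn ℂ (deriv f) (ball (0 : ℂ) ρ) := hf.deriv isOpen_ball
  have hsub : closedBall σ (ρ / 8) ⊆ ball (0 : ℂ) ρ := closedBall_subset_ball' hσ (by linarith)
  have hd' : DiffContOnCl ℂ (deriv f) (ball σ (ρ / 8)) := by
    refine DifferentiableOn.diffContOnCl ?_
    rw [closure_ball σ (by positivity : (ρ / 8) ≠ 0)]
    exact hD.mono hsub
  refine Complex.norm_deriv_le_of_forall_mem_sphere_norm_le (by positivity) hd' ?_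
  intro z hz
  have hz1 : ‖z - σ‖ = ρ / 8 := by rw [mem_sphere, dist_eq_norm] at hz; exact hz
  have hz2 : ‖z‖ ≤ ρ / 4 := by
    calc ‖z‖ = ‖(z - σ) + σ‖ := by rw [sub_add_cancel]
      _ ≤ ‖z - σ‖ + ‖σ‖ := norm_add_le _ _
      _ ≤ ρ / 8 + ρ / 8 := add_le_add hz1.le hσ
      _ = ρ / 4 := by ring
  exact norm_deriv_le_of_osc_ball hρ hf hB hz2

/-- ★ **SECOND ORDER UNDER A VANISHING DERIVATIVE.**  `f` complex-differentiable on `ball 0 ρ` with oscillation `‖f z − f 0‖ ≤ B`, and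
`deriv f 0 = 0`: for `‖s‖ ≤ ρ∕8`, `‖f s − f 0‖ ≤ (32B∕ρ²)·‖s‖²` (mean value for `f′` along `[0, σ]` — `‖f′ σ‖ ≤ (32B∕ρ²)‖σ‖` — then for `f`
along `[0, s]`). [folklore] -/
theorem norm_sub_le_sq_of_deriv_eq_zero (hρ : 0 < ρ) (hf : DifferentiableOn ℂ f (ball (0 : ℂ) ρ))
    (hB : ∀ z ∈ ball (0 : ℂ) ρ, ‖f z - f 0‖ ≤ B) (h0 : deriv f 0 = 0) {s : ℂ} (hs : ‖s‖ ≤ ρ / 8) :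
    ‖f s - f 0‖ ≤ 32 * B / ρ ^ 2 * ‖s‖ ^ 2 := by
  have hD : DifferentiableOn ℂ (deriv f) (ball (0 : ℂ) ρ) := hf.deriv isOpen_ball
  have hK : closedBall (0 : ℂ) (ρ / 8) ⊆ ball (0 : ℂ) ρ := closedBall_subset_ball' (δ := 0) (by simp) (by linarith)
  have hconv : Convex ℝ (closedBall (0 : ℂ) (ρ / 8)) := convex_closedBall _ _
  have h0m : (0 : ℂ) ∈ closedBall (0 : ℂ) (ρ / 8) := mem_closedBall_self (by positivity)
  have hsm : s ∈ closedBall (0 : ℂ) (ρ / 8) := by rwa [mem_closedBall, dist_zero_right]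
  -- first: ‖f′ σ‖ ≤ C‖σ‖ on the small closed disc
  have hder : ∀ σ ∈ closedBall (0 : ℂ) (ρ / 8), ‖deriv f σ‖ ≤ (2 * B / (ρ / 2)) / (ρ / 8) * (ρ / 8) := by
    intro σ hσ
    have hσ' : ‖σ‖ ≤ ρ / 8 := by rwa [mem_closedBall, dist_zero_right] at hσ
    have hdiff : ∀ x ∈ closedBall (0 : ℂ) (ρ / 8), DifferentiableAt ℂ (deriv f) x :=
      fun x hx => hD.differentiableAt (isOpen_ball.mem_nhds (hK hx))
    have hbd : ∀ x ∈ closedBall (0 : ℂ) (ρ / 8), ‖deriv (deriv f) x‖ ≤ (2 * B / (ρ / 2)) / (ρ / 8) := by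
      intro x hx
      have hx' : ‖x‖ ≤ ρ / 8 := by rwa [mem_closedBall, dist_zero_right] at hx
      exact norm_deriv_deriv_le hρ hf hB hx'
    have key := hconv.norm_image_sub_le_of_norm_deriv_le hdiff hbd h0m hσ
    rw [h0, sub_zero, sub_zero] at key
    calc ‖deriv f σ‖ ≤ (2 * B / (ρ / 2)) / (ρ / 8) * ‖σ‖ := key
      _ ≤ (2 * B / (ρ / 2)) / (ρ / 8) * (ρ / 8) := by
          have hB0 : 0 ≤ B := by
            have := hB 0 (mem_ball_self hρ); simp at this; exact this
          gcongr
  -- refine: on the segment [0, s] the sharper bound ‖f′ σ‖ ≤ C‖σ‖ ≤ C‖s‖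
  have hder' : ∀ σ ∈ segment ℝ (0 : ℂ) s, ‖deriv f σ‖ ≤ (2 * B / (ρ / 2)) / (ρ / 8) * ‖s‖ := by
    intro σ hσ
    have hσK : σ ∈ closedBall (0 : ℂ) (ρ / 8) := (convex_closedBall _ _).segment_subset h0m hsm hσ
    have hdiff : ∀ x ∈ closedBall (0 : ℂ) (ρ / 8), DifferentiableAt ℂ (deriv f) x :=
      fun x hx => hD.differentiableAt (isOpen_ball.mem_nhds (hK hx))
    have hbd : ∀ x ∈ closedBall (0 : ℂ) (ρ / 8), ‖deriv (deriv f) x‖ ≤ (2 * B / (ρ / 2)) / (ρ / 8) := by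
      intro x hx
      have hx' : ‖x‖ ≤ ρ / 8 := by rwa [mem_closedBall, dist_zero_right] at hx
      exact norm_deriv_deriv_le hρ hf hB hx'
    have key := hconv.norm_image_sub_le_of_norm_deriv_le hdiff hbd h0m hσK
    rw [h0, sub_zero, sub_zero] at key
    have hσs : ‖σ‖ ≤ ‖s‖ := by
      rw [segment_eq_image'] at hσ
      obtain ⟨θ, hθ, rfl⟩ := hσ
      simp only [zero_add, sub_zero, norm_smul, Real.norm_eq_abs, abs_of_nonneg hθ.1]
      calc θ * ‖s‖ ≤ 1 * ‖s‖ := by gcongr; exact hθ.2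
        _ = ‖s‖ := one_mul _
    have hC : 0 ≤ (2 * B / (ρ / 2)) / (ρ / 8) := by
      have hB0 : 0 ≤ B := by
        have := hB 0 (mem_ball_self hρ); simp at this; exact this
      positivity
    exact key.trans (mul_le_mul_of_nonneg_left hσs hC)
  have hdiffF : ∀ x ∈ segment ℝ (0 : ℂ) s, DifferentiableAt ℂ f x :=
    fun x hx => hf.differentiableAt (isOpen_ball.mem_nhds (hK ((convex_closedBall _ _).segment_subset h0m hsm hx)))
  have key := (convex_segment (0 : ℂ) s).norm_image_sub_le_of_norm_deriv_le hdiffF hder'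
    (left_mem_segment ℝ _ _) (right_mem_segment ℝ _ _)
  rw [sub_zero] at key
  calc ‖f s - f 0‖ ≤ (2 * B / (ρ / 2)) / (ρ / 8) * ‖s‖ * ‖s‖ := key
    _ = 32 * B / ρ ^ 2 * ‖s‖ ^ 2 := by field_simp; ring

/-- ★ SCALED∕REAL READING (window scale `θ`, chart radius `ρ = r·θ`; the organ's moves are real): for `|s| ≤ r·θ∕8` and real values
`f ↑s = ↑φs`, `f 0 = ↑φ0`: `|φs − φ0| ≤ (32B∕r²)·(|s|∕θ)²`. [folklore] -/
theorem abs_sub_le_sq_scaled_real {θ r : ℝ} (hθ : 0 < θ) (hr : 0 < r)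
    (hf : DifferentiableOn ℂ f (ball (0 : ℂ) (r * θ))) (hB : ∀ z ∈ ball (0 : ℂ) (r * θ), ‖f z - f 0‖ ≤ B)
    (h0 : deriv f 0 = 0) {s : ℝ} (hs : |s| ≤ r * θ / 8) {φs φ0 : ℝ} (hφs : f (s : ℂ) = φs) (hφ0 : f 0 = φ0) :
    |φs - φ0| ≤ 32 * B / r ^ 2 * (|s| / θ) ^ 2 := by
  have hs' : ‖(s : ℂ)‖ ≤ r * θ / 8 := by rwa [Complex.norm_real, Real.norm_eq_abs]
  have key := norm_sub_le_sq_of_deriv_eq_zero (mul_pos hr hθ) hf hB h0 hs'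
  rw [hφs, hφ0, Complex.norm_real, Real.norm_eq_abs] at key
  have hcast : ((φs : ℂ) - φ0) = ((φs - φ0 : ℝ) : ℂ) := by push_cast; ring
  rw [hcast, Complex.norm_real, Real.norm_eq_abs] at key
  calc |φs - φ0| ≤ 32 * B / (r * θ) ^ 2 * |s| ^ 2 := key
    _ = 32 * B / r ^ 2 * (|s| / θ) ^ 2 := by field_simp

end OneVariable

/-! ## §2 (iv) from (β): the real trace of a holomorphic function is differentiable, and its real derivative is the complex one -/

section RealTrace

variable {f : ℂ → ℂ} {φ : ℝ → ℝ} {ρ : ℝ}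

/-- ★ **(iv) FROM (β).**  If `f` is complex-differentiable on `ball 0 ρ` (`0 < ρ`) and `φ : ℝ → ℝ` is its real trace near `0`
(`f ↑s = ↑(φ s)` for `|s| < ρ`), then `φ` has derivative `(deriv f 0).re` at `0` and `deriv f 0 = ↑(deriv φ 0)`. [folklore] -/
theorem hasDerivAt_realTrace (hρ : 0 < ρ) (hf : DifferentiableOn ℂ f (ball (0 : ℂ) ρ))
    (hφ : ∀ s : ℝ, |s| < ρ → f (s : ℂ) = ((φ s : ℝ) : ℂ)) :
    HasDerivAt φ (deriv f 0).re 0 ∧ deriv f 0 = ((deriv φ 0 : ℝ) : ℂ) := by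
  have hfd : HasDerivAt f (deriv f 0) ((0 : ℝ) : ℂ) := by
    rw [Complex.ofReal_zero]
    exact (hf.differentiableAt (isOpen_ball.mem_nhds (mem_ball_self hρ))).hasDerivAt
  have h1 : HasDerivAt (fun y : ℝ => f (y : ℂ)) (deriv f 0) 0 := hfd.comp_ofReal
  -- the trace agrees with `fun y => ↑(φ y)` near 0
  have hEq : (fun y : ℝ => f (y : ℂ)) =ᶠ[nhds 0] fun y : ℝ => ((φ y : ℝ) : ℂ) := by
    have : Ioo (-ρ) ρ ∈ nhds (0 : ℝ) := Ioo_mem_nhds (by linarith) hρ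
    filter_upwards [this] with y hy
    exact hφ y (abs_lt.mpr ⟨hy.1, hy.2⟩)
  have h2 : HasDerivAt (fun y : ℝ => ((φ y : ℝ) : ℂ)) (deriv f 0) 0 := h1.congr_of_eventuallyEq hEq.symm
  -- real part
  have h3 : HasDerivAt (fun y : ℝ => (((φ y : ℝ) : ℂ)).re) (Complex.reCLM (deriv f 0)) 0 :=
    (Complex.reCLM.hasFDerivAt.comp_hasDerivAt 0 h2)
  have h4 : HasDerivAt φ (deriv f 0).re 0 := by
    simpa using h3
  refine ⟨h4, ?_⟩
  -- the complex derivative is real: compare with the `ofReal ∘ φ` derivative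
  have h5 : HasDerivAt (fun y : ℝ => ((φ y : ℝ) : ℂ)) (((deriv φ 0 : ℝ) : ℂ)) 0 := by
    have := h4.ofReal_comp
    rw [h4.deriv]
    exact this
  exact h2.unique h5

/-- ★ If the real trace has zero derivative at `0` (e.g. by ✓p794698 ∕ ✓p793256: gauge invariance at the flat anchor), so does `f`.
[folklore] -/
theorem deriv_eq_zero_of_realTrace (hρ : 0 < ρ) (hf : DifferentiableOn ℂ f (ball (0 : ℂ) ρ))
    (hφ : ∀ s : ℝ, |s| < ρ → f (s : ℂ) = ((φ s : ℝ) : ℂ)) (h0 : deriv φ 0 = 0) : deriv f 0 = 0 := by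
  rw [(hasDerivAt_realTrace hρ hf hφ).2, h0, Complex.ofReal_zero]

/-- The real trace is differentiable at `0` — hypothesis (iv) of ✓`deriv_flatBond_organDiscrepancy_eq_zero` ∕ ✓`deriv_flatBond_eq_zero`,
discharged from (β). [folklore] -/
theorem differentiableAt_realTrace (hρ : 0 < ρ) (hf : DifferentiableOn ℂ f (ball (0 : ℂ) ρ))
    (hφ : ∀ s : ℝ, |s| < ρ → f (s : ℂ) = ((φ s : ℝ) : ℂ)) : DifferentiableAt ℝ φ 0 :=
  (hasDerivAt_realTrace hρ hf hφ).1.differentiableAt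

end RealTrace

/-! ## §3 Docked: the organ's remainder moves by `O((|s|∕θ)²)` along a one-bond move from the flat anchor -/

section Dock

variable (F : T3Family) {j : ℕ} {prm : ClassParams}
variable {ρj ρ'j : GaugeField (F.P j) 0 (Matrix.specialUnitaryGroup (Fin 2) ℂ) → ℝ}

/-- ★★ **THE SECOND-ORDER ANCHOR LETTER FOR THE ORGAN'S REMAINDER.**  In the frame of O1 (clause ⑧ at height `j` for both towers), let
`Rem U := log ρ_j U − log ρ′_j U − a·Σ_p c_p (1 − reTr U(∂p))`, `b` a bond, `e` an inversion-odd one-bond curve through the identity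
(`e(−t) = (e t)⁻¹`), and suppose the (β)-shaped one-parameter datum: `f : ℂ → ℂ` complex-differentiable on `ball 0 (r·θ)` with
oscillation `‖f z − f 0‖ ≤ B`, whose real trace is the remainder along the move, `f ↑t = ↑(Rem (update 1 b (e t)))` for `|t| < r·θ`.  Then
for `|s| ≤ r·θ∕8`: `|Rem (update 1 b (e s)) − Rem 1| ≤ (32B∕r²)·(|s|∕θ)²`.  (First order killed by ✓p794698's
`deriv_flatBond_organDiscrepancy_eq_zero` with (iv) from §2; second order by §1.) [folklore] -/
theorem abs_flatBond_organDiscrepancy_sub_le_sq [DecidableEq (PBond (F.P j) 0)]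
    (h8 : ∃ κ : ℝ, MemAtHeight F ℰp j prm (fun U => Real.exp κ * ρj U))
    (h8' : ∃ κ : ℝ, MemAtHeight F ℰp j prm (fun U => Real.exp κ * ρ'j U)) (a : ℝ) (c : Plaq (F.P j) 0 → ℝ)
    (b : PBond (F.P j) 0) {e : ℝ → Matrix.specialUnitaryGroup (Fin 2) ℂ} (he : ∀ t, e (-t) = (e t)⁻¹) (he0 : e 0 = 1)
    {θ r B : ℝ} (hθ : 0 < θ) (hr : 0 < r) {f : ℂ → ℂ} (hf : DifferentiableOn ℂ f (ball (0 : ℂ) (r * θ)))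
    (hB : ∀ z ∈ ball (0 : ℂ) (r * θ), ‖f z - f 0‖ ≤ B)
    (htrace : ∀ t : ℝ, |t| < r * θ → f (t : ℂ) =
      (((Real.log (ρj (update 1 b (e t))) - Real.log (ρ'j (update 1 b (e t))) -
        a * ∑ p, c p * (1 - reTr (GaugeField.plaqHol (update (1 : GaugeField (F.P j) 0 (Matrix.specialUnitaryGroup (Fin 2) ℂ)) b (e t)) p)) : ℝ) : ℂ)))
    {s : ℝ} (hs : |s| ≤ r * θ / 8) :
    |(Real.log (ρj (update 1 b (e s))) - Real.log (ρ'j (update 1 b (e s))) -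
        a * ∑ p, c p * (1 - reTr (GaugeField.plaqHol (update (1 : GaugeField (F.P j) 0 (Matrix.specialUnitaryGroup (Fin 2) ℂ)) b (e s)) p))) -
      (Real.log (ρj 1) - Real.log (ρ'j 1) -
        a * ∑ p, c p * (1 - reTr (GaugeField.plaqHol (1 : GaugeField (F.P j) 0 (Matrix.specialUnitaryGroup (Fin 2) ℂ)) p)))| ≤
      32 * B / r ^ 2 * (|s| / θ) ^ 2 := by
  have hρ : 0 < r * θ := mul_pos hr hθ
  -- the remainder functional and its real trace along the move
  set R : GaugeField (F.P j) 0 (Matrix.specialUnitaryGroup (Fin 2) ℂ) → ℝ := fun U =>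
      Real.log (ρj U) - Real.log (ρ'j U) - a * ∑ p, c p * (1 - reTr (GaugeField.plaqHol U p)) with hR
  set φ : ℝ → ℝ := fun t => R (update 1 b (e t)) with hφ
  have htrace' : ∀ t : ℝ, |t| < r * θ → f (t : ℂ) = ((φ t : ℝ) : ℂ) := fun t ht => htrace t ht
  -- (iv) from (β), then the first-order kill (✓p794698), then transport to f
  have hiv : DifferentiableAt ℝ φ 0 := differentiableAt_realTrace hρ hf htrace'
  have hφ0 : deriv φ 0 = 0 := deriv_flatBond_organDiscrepancy_eq_zero F h8 h8' a c b he hiv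
  have hf0 : deriv f 0 = 0 := deriv_eq_zero_of_realTrace hρ hf htrace' hφ0
  -- values at s and 0
  have hslt : |s| < r * θ := lt_of_le_of_lt hs (by linarith)
  have hvs : f (s : ℂ) = ((φ s : ℝ) : ℂ) := htrace' s hslt
  have hv0 : f 0 = ((φ 0 : ℝ) : ℂ) := by
    have := htrace' 0 (by rw [abs_zero]; exact hρ)
    rwa [Complex.ofReal_zero] at this
  have key := abs_sub_le_sq_scaled_real hθ hr hf hB hf0 hs hvs hv0
  have hU : update (1 : GaugeField (F.P j) 0 (Matrix.specialUnitaryGroup (Fin 2) ℂ)) b (e 0) = 1 := by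
    rw [he0]; exact Function.update_eq_self_iff.mpr rfl
  have hφ0v : φ 0 = R 1 := congrArg R hU
  rw [hφ0v] at key
  exact key

end Dock

end Summit.QuantumFields.YangMills.Theorems.OrganTangentAnchorSecondOrder

end
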